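import Summits.CriticalPhenomena.PercolationContinuityZ3.Theorems.PercNearOneGluingNoHeavyLowerTailSahiHubCornerChain
import Mathlib.Tactic.Linarith
import Mathlib.Tactic.FinCases
import HarnessLib

/-!
# `NoHeavyLowerTail` (crux stmt-CriticalPhenomena-4575), P2 — T₁ WITH JOINTLY NESTED CO-SHARED SECTIONS (any block, any weight)

Seat `prim-masterthm-p2`, gen 31 (memo `FROM-prim-masterthm-p2-g31-PAIR-DECOMPOSITION.md` §1, SAHI-ROUTE.md §4.58; `--supports stmt-CriticalPhenomena-4575`).
No `sorry`, no named facts, standard axioms.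

`…SahiHubCornerChain` proved `2q₁ = Σ_x Σ_y wC(x)wC(y)·CF(x,y)` on ANY finite block and `CF(x,y) ≥ 0` for points whose sections are nested in the
block order.  The order of the block is irrelevant for the pair form: `CF(x,y) = crossForm` of the two-point family is `≥ 0` as soon as the sections AT THE TWO
POINTS are nested the same way for both co-sharing members (`pairForm_nonneg_of_nested`, again literally `SahiHubTwoLevel.crossForm_nonneg`).  Hence:
* `cornerQ1_nonneg_of_jointlyNested`, `cornerQ0_nonneg_of_jointlyNested`: **Q holds on ANY finite block with ANY probability weight whenever the section
  families `c ↦ f(·,c,·)` and `c ↦ g(·,c,·)` are JOINTLY NESTED** (for every two block points `x, y`: `f^x ≤ f^y ∧ g^x ≤ g^y` or `f^y ≤ f^x ∧ g^y ≤ g^x`) — no order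
  or lattice structure on the block is used;
* `sahiE_three_nonneg_T1_of_jointlyNested`: **Kahn's `C₃` for `f(z,c,a), g(z,c,b), h(z,a,b)` over ANY FKG co-shared block `γ`** (cube `{0,1}^k` with a product law,
  …) **whenever the two co-sharing members have jointly nested `γ`-sections** — e.g. both depend on the co-shared coordinates through a common monotone
  totally ordered statistic (`f = f̃(z, φ(c), a)`, `g = g̃(z, φ(c), b)`, `φ : γ → L` monotone, `L` a chain: the number of open co-shared edges, their maximum, …).
  The chain theorem `sahiE_three_nonneg_T1_chain` is the case `φ = id`.
HONEST LABEL: a face of T₁ (jointly nested co-shared sections) PROVED for every FKG block; general T₁ (discordant / incomparable section pairs) and Kahn's `C₃` OPEN. [this work]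
-/

noncomputable section

open scoped Classical

namespace Summit.CriticalPhenomena.PercolationContinuityZ3.Theorems

namespace SahiHubCornerChain

open Finset Literature.Combinatorics.Sahi2008 SahiHubCorner SahiHubTwoLevel

variable {α β γ : Type} [Fintype α] [Fintype β] [Fintype γ]
  {wA : α → ℝ} {wB : β → ℝ} {wC : γ → ℝ}
  {f : Fin 2 → γ → α → ℝ} {g : Fin 2 → γ → β → ℝ} {h : Fin 2 → α → β → ℝ}

omit [Fintype γ] in
/-- **NESTED POINT PAIRS ARE NONNEGATIVE** (no order on the block needed): if the sections at `x` lie below the sections at `y` for BOTH co-sharing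
members, then `CF(x,y) ≥ 0` — `SahiHubTwoLevel.crossForm_nonneg` for the two-point family. [this work] -/
theorem pairForm_nonneg_of_nested [DistribLattice α] [DistribLattice β]
    (hA : IsFKGMeasure wA) (hB : IsFKGMeasure wB) {x y : γ}
    (hfxy : ∀ z a, f z x a ≤ f z y a) (hgxy : ∀ z b, g z x b ≤ g z y b)
    (hf0 : ∀ z c a, 0 ≤ f z c a) (hfa : ∀ z c, Monotone (f z c)) (hfz : ∀ c a, f 0 c a ≤ f 1 c a)
    (hg0 : ∀ z c b, 0 ≤ g z c b) (hgb : ∀ z c, Monotone (g z c)) (hgz : ∀ c b, g 0 c b ≤ g 1 c b)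
    (hh0 : ∀ z a b, 0 ≤ h z a b) (hha : ∀ z b, Monotone (fun a => h z a b)) (hhb : ∀ z a, Monotone (h z a))
    (hhz : ∀ a b, h 0 a b ≤ h 1 a b) :
    0 ≤ pairForm wA wB f g h x y := by
  unfold pairForm
  refine crossForm_nonneg hA hB ?_ ?_ ?_ ?_ ?_ ?_ ?_ ?_ hh0 hha hhb hhz
  · intro i z a; fin_cases i <;> simp [fpair, hf0]
  · intro z a; simpa [fpair] using hfxy z a
  · intro i z a a' haa; fin_cases i <;> simp [fpair] <;> exact hfa z _ haa
  · intro i a; fin_cases i <;> simp [fpair, hfz]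
  · intro j z b; fin_cases j <;> simp [gpair, hg0]
  · intro z b; simpa [gpair] using hgxy z b
  · intro j z b b' hbb; fin_cases j <;> simp [gpair] <;> exact hgb z _ hbb
  · intro j b; fin_cases j <;> simp [gpair, hgz]

/-- **Q ON ANY BLOCK WITH JOINTLY NESTED SECTIONS, corner `t = 1`.**  `γ` any finite type, `wC ≥ 0` of mass one; if for every two block points the
sections of `f` AND of `g` are nested the same way, then `q₁ ≥ 0`. [this work] -/
theorem cornerQ1_nonneg_of_jointlyNested [DistribLattice α] [DistribLattice β]
    (hA : IsFKGMeasure wA) (hB : IsFKGMeasure wB) (hC0 : ∀ c, 0 ≤ wC c) (hC1 : ∑ c, wC c = 1)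
    (hcomp : ∀ x y : γ, ((∀ z a, f z x a ≤ f z y a) ∧ ∀ z b, g z x b ≤ g z y b) ∨ ((∀ z a, f z y a ≤ f z x a) ∧ ∀ z b, g z y b ≤ g z x b))
    (hf0 : ∀ z c a, 0 ≤ f z c a) (hfa : ∀ z c, Monotone (f z c)) (hfz : ∀ c a, f 0 c a ≤ f 1 c a)
    (hg0 : ∀ z c b, 0 ≤ g z c b) (hgb : ∀ z c, Monotone (g z c)) (hgz : ∀ c b, g 0 c b ≤ g 1 c b)
    (hh0 : ∀ z a b, 0 ≤ h z a b) (hha : ∀ z b, Monotone (fun a => h z a b)) (hhb : ∀ z a, Monotone (h z a))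
    (hhz : ∀ a b, h 0 a b ≤ h 1 a b) :
    0 ≤ cornerQ1 wA wB wC f g h := by
  refine cornerQ1_nonneg_of_pairForm hA.sum_eq_one hB.sum_eq_one hC0 hC1 fun x y => ?_
  rcases hcomp x y with ⟨hf, hg⟩ | ⟨hf, hg⟩
  · exact pairForm_nonneg_of_nested hA hB hf hg hf0 hfa hfz hg0 hgb hgz hh0 hha hhb hhz
  · rw [pairForm_symm]
    exact pairForm_nonneg_of_nested hA hB hf hg hf0 hfa hfz hg0 hgb hgz hh0 hha hhb hhz

/-- **Q ON ANY BLOCK WITH JOINTLY NESTED SECTIONS, corner `t = 0`** (`q₀ = q₁ + Δf·Δg·Δh ≥ q₁`). [this work] -/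
theorem cornerQ0_nonneg_of_jointlyNested [DistribLattice α] [DistribLattice β]
    (hA : IsFKGMeasure wA) (hB : IsFKGMeasure wB) (hC0 : ∀ c, 0 ≤ wC c) (hC1 : ∑ c, wC c = 1)
    (hcomp : ∀ x y : γ, ((∀ z a, f z x a ≤ f z y a) ∧ ∀ z b, g z x b ≤ g z y b) ∨ ((∀ z a, f z y a ≤ f z x a) ∧ ∀ z b, g z y b ≤ g z x b))
    (hf0 : ∀ z c a, 0 ≤ f z c a) (hfa : ∀ z c, Monotone (f z c)) (hfz : ∀ c a, f 0 c a ≤ f 1 c a)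
    (hg0 : ∀ z c b, 0 ≤ g z c b) (hgb : ∀ z c, Monotone (g z c)) (hgz : ∀ c b, g 0 c b ≤ g 1 c b)
    (hh0 : ∀ z a b, 0 ≤ h z a b) (hha : ∀ z b, Monotone (fun a => h z a b)) (hhb : ∀ z a, Monotone (h z a))
    (hhz : ∀ a b, h 0 a b ≤ h 1 a b) :
    0 ≤ cornerQ0 wA wB wC f g h := by
  rw [cornerQ0_eq]
  have h1 := cornerQ1_nonneg_of_jointlyNested hA hB hC0 hC1 hcomp hf0 hfa hfz hg0 hgb hgz hh0 hha hhb hhz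
  have hF := exL_F1_sub_nonneg (f := f) (wC := wC) hA.nonneg hB.sum_eq_one hC0 hfz
  have hG := exL_F2_sub_nonneg (g := g) (wC := wC) hA.sum_eq_one hB.nonneg hC0 hgz
  have hH := exL_F3_sub_nonneg (h := h) (wC := wC) hA.nonneg hB.nonneg hC1 hhz
  have := mul_nonneg (mul_nonneg hF hG) hH
  linarith

/-- **THEOREM (T₁ WITH JOINTLY NESTED CO-SHARED SECTIONS, ANY FKG BLOCK).**  Hub coin `z` with any weight `wZ ≥ 0` of mass one; co-shared block `γ`
of the first two members ANY finite distributive lattice with an FKG probability weight `wC` (e.g. a cube `{0,1}^k` with a product law); private FKG blocks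
`α, β`; `f(z,c,a), g(z,c,b), h(z,a,b)` nonnegative and monotone in every argument; and the `γ`-sections of `f` and `g` JOINTLY NESTED (`hcomp`; e.g. both
depend on `c` through a common monotone chain-valued statistic).  Then Sahi's `E₃(f,g,h) ≥ 0` (Kahn's `C₃`). [this work] -/
theorem sahiE_three_nonneg_T1_of_jointlyNested [DistribLattice α] [DistribLattice β] [DistribLattice γ] {wZ : Fin 2 → ℝ}
    (hA : IsFKGMeasure wA) (hB : IsFKGMeasure wB) (hC : IsFKGMeasure wC)
    (hZ0 : 0 ≤ wZ 0) (hZ1 : 0 ≤ wZ 1) (hZ : wZ 0 + wZ 1 = 1)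
    (hcomp : ∀ x y : γ, ((∀ z a, f z x a ≤ f z y a) ∧ ∀ z b, g z x b ≤ g z y b) ∨ ((∀ z a, f z y a ≤ f z x a) ∧ ∀ z b, g z y b ≤ g z x b))
    (hf0 : ∀ z c a, 0 ≤ f z c a) (hfa : ∀ z c, Monotone (f z c)) (hfc : ∀ z a, Monotone (fun c => f z c a))
    (hfz : ∀ c a, f 0 c a ≤ f 1 c a)
    (hg0 : ∀ z c b, 0 ≤ g z c b) (hgb : ∀ z c, Monotone (g z c)) (hgc : ∀ z b, Monotone (fun c => g z c b))
    (hgz : ∀ c b, g 0 c b ≤ g 1 c b)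
    (hh0 : ∀ z a b, 0 ≤ h z a b) (hha : ∀ z b, Monotone (fun a => h z a b)) (hhb : ∀ z a, Monotone (h z a))
    (hhz : ∀ a b, h 0 a b ≤ h 1 a b) :
    0 ≤ sahiE (W wA wB wC wZ) 3 ![F1 f, F2 g, F3 h] :=
  sahiE_three_nonneg_T1_of_corner hA hB hC hZ0 hZ1 hZ hf0 hfa hfc hg0 hgb hgc hh0 hha hhb
    (cornerQ0_nonneg_of_jointlyNested hA hB hC.nonneg hC.sum_eq_one hcomp hf0 hfa hfz hg0 hgb hgz hh0 hha hhb hhz)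
    (cornerQ1_nonneg_of_jointlyNested hA hB hC.nonneg hC.sum_eq_one hcomp hf0 hfa hfz hg0 hgb hgz hh0 hha hhb hhz)

end SahiHubCornerChain

end Summit.CriticalPhenomena.PercolationContinuityZ3.Theorems
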